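import Literature.MathematicalPhysics.QuantumFieldTheory.Balaban1983to89.T4ShellMeasureAnalytic

/-!
# `Balaban1983to89.T4ShellMeasureToron` — node U5b, cell input NE7c, SHELL-MEASURE ROUTE: the TORON SECTOR of the
analytic dilation (member (γ″)) DECIDED, and its repair (member (γ‴)) by NEAR-HOMOGENEOUS profiles of degree `m`

(cell `pub-balaban`, T4-DAG v21 §6 row NE7c, fan-out seat `b2b-balaban-t4-ne7c-p1` gen 7, design row
T4-U5b.E2-NE7c-PROVE-P1g*; Mathlib + `T4ShellMeasureAnalytic` only; companion record `t4/T4-EST-NE7c-P1.md` §3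
(γ″)/(γ‴); v1.)

HONEST FRAMING (cell `pub-balaban`, T4-DAG PAGE 1).  Rung (B)+1 scoping of the T⁴-continuum cell (existence and
uniqueness of the `ε → 0` limit of unit-scale averaged expectations on a FIXED finite torus): NOT infinite volume, NOT
a mass gap, NOT Clay, NOT summit progress and NOT a proof of NE7c.  NOTHING below is a statement about Bałaban's
densities: every `def … : Prop`-valued shape is a hypothesis SHAPE, every theorem is elementary linear algebra in
`ℝ³`, calculus in a Banach algebra, or real / inner-product-space analysis ([folklore]); the located inputs of the
members — (AN-inst) resp. (AN-inst₂), (SM) resp. (SM₂), (DC-fwd), (SS′), (GOOD′), (TS) — are NOT PRINTED in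
[Balaban 1983–89] as inequalities and enter as explicit named binders; every conditional of the cell (BetaPertH,
(B), (B^μ)) stays where it is — at the node consuming `T4IndicatorShell.ShellWeightBound` — untouched and unhidden.

WHY THIS LEAF.  Member (γ″) (`T4ShellMeasureAnalytic`, gen 6) decides, fibre by fibre of the GLOBAL dilation of a
good live level from the nearest FLAT connection, between "never reaches the shell" and "two-sided with a small
defect" by ONE smallness relation (SM) `(C₀ + C₁)·x₀² ≤ s·θ(1 − ρ)`, where `x₀` is the gauge distance of the
configuration to the flat connections and `C₀, C₁` are the Cauchy constants of the plaquette functionals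
`h_p(z) = U_k(exp(i z ω))(∂p) − 1` ("near-linear": `‖h_p(z) − z a_p‖ ≤ C₀z²`).  Its record (v1.7/v1.8 §3, GAPS
G-ne7cp1-11a) left ONE caveat: in the TORON sector of the torus — configurations close to a flat connection with
non-trivial COMMUTING holonomies — `x₀` is governed by the modulus of "almost-commuting ⇒ near-commuting" for the
holonomy generators, which was unlocated; if that modulus is only Hölder-1/2, (SM) degenerates.  This leaf DECIDES
the caveat — against (γ″) — and types the repair:
(1) §1: in `su(2) ≅ (ℝ³, ×)` (the case `G = SU(2)`; the bracket of `a·L, b·L` is `(a × b)·L`; for `SU(N)` the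
    commuting variety is not a dependent cone and only the MECHANISM, not the constants, is claimed — nothing of §1
    is used in §3–§4) the `ℓ²`-distance `D` of a pair `(a, b)` of generators to the COMMUTING
    (= linearly dependent) pairs satisfies `D²·max(|a|², |b|²) ≤ |a × b|²` and `D⁴ ≤ |a × b|²` (project the shorter
    vector onto the longer; Lagrange's identity `Matrix.cross_dot_cross`), and the exponent `1/2` is SHARP at the flat
    point: for `a = t e₀, b = t e₁` EVERY commuting pair is at squared distance `≥ t² = |a × b|` (AM–GM on the
    `2 × 2` minors).  So the modulus is exactly Hölder-1/2 and NOT Lipschitz (`not_lipschitz_modulus`): along a ray of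
    toron-type configurations of amplitude `t` the commutator — the plaquette variable of a uniform configuration — is
    QUADRATIC in `t`, the distance to the flat variety is LINEAR in `t`.
(2) §2: in any complete normed algebra the group commutator of two one-parameter subgroups,
    `z ↦ e^{zA} e^{zB} e^{−zA} e^{−zB}`, equals `1` at `z = 0`, has DERIVATIVE `0` there
    (`hasDerivAt_commPath_zero`) and its derivative has derivative `2(AB − BA)` at `0`
    (`hasDerivAt_commPathDeriv_zero`): the near-linear coefficient `a_p` of (γ″) VANISHES along toron rays — they
    are NON-TRANSVERSAL in the sense of `T4ShellMeasureAnalytic` §3 — and the degree-2 coefficient is the Lie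
    bracket of the holonomy generators (for `su(2)`: the cross product of §1).
(3) §3 (typed NEGATIVE, against my own member): a direction whose profile is purely quadratic (`a_p = 0`,
    `‖h_p z‖ ≤ C₀z²` on `(0, x₀]`) and which REACHES the shell level `lo = θ(1 − ρ)` within the physical range
    forces `lo ≤ C₀x₀²`, which contradicts (SM) for every `s < 1` (`not_SM_of_quadratic_reach`); conversely under (SM)
    such a direction never reaches the shell (`nonTransversal_zero_of_SM`).  Hence (γ″) covers exactly the fibres on
    which no toron-type plaquette reaches the shell; the BAD-TORON BAND — nearly commuting uniform holonomy generators
    of amplitude² comparable to `θ_j`, where the commutators DO reach the shell while `x₀ ≳ θ_j^{1/2}` — is NOT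
    covered by (γ″): there (SM) is an inequality between fixed constants, and it is false.  (The single-run weight
    of that band at fixed live age is `K`-independent, hence not summable in `K`: recorded as an OBJECTION, GAPS
    G-ne7cp1-11b, not as a theorem about the densities.)
(4) §4 (REPAIR, member (γ‴)): NEAR-HOMOGENEOUS profiles of degree `m ≥ 1` along the fibre,
    `‖h z − z^m • b‖ ≤ C₀z^{m+1}`, `‖h′ z − (m z^{m−1}) • b‖ ≤ C₁z^m` on `(0, x₀]`, read in the clock `z = e^{−r/m}`
    (`normProfileDeg m`; `m = 1` is literally §3 of `T4ShellMeasureAnalytic`, `normProfileDeg_one`): the relative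
    Euler defect of the degree-`2m` intensity `‖h‖²` is `≤ (C₀ + C₁/m)z/(‖b‖ − C₀z)`, TRANSVERSAL directions
    (`‖b‖ ≥ lo/x₀^m − C₀x₀`) are two-sided with defect `s/(1 − 2s)` under the smallness relation (SM_m)
    `(C₀ + C₁)x₀^{m+1} ≤ s·lo`, NON-TRANSVERSAL ones never reach the shell, finite families via the transversal
    `sup'` (no union bound), ending in `T4ShellMeasureAnalytic.FibreAlternative` BY NAME
    (`fibreAlternative_of_nearHomogeneous_family`).  The toron sector is the case `m = 2` along TWO-SPEED rays
    (holonomy / harmonic modes at weight `t`, fluctuation modes at weight `t²`; located construction input (TS)):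
    every plaquette functional is then near-homogeneous of degree `2` with coefficient
    `b_p = a_p(fluctuation) + [A_μ, A_ν]_p(holonomy)`, and (SM₂) `(C₀ + C₁)x₀³ ≤ s·θ(1 − ρ)` with `x₀ ≈ θ_j^{1/2}`
    reads `θ_j^{1/2} ≲ s` — an eventually-in-`j` smallness of the SAME type as (SM), true in the bad-toron band too.
(5) §5: non-vacuity (the exactly homogeneous model `h z = z^m • b` meets every hypothesis with `C₀ = C₁ = 0`).

DICTIONARY / LOCATED INPUTS of member (γ‴) (renders read this and the previous generations; record §3/§4):
(AN-inst₂) near-homogeneity of degree 2 of the plaquette functionals along two-speed rays with `K`-independent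
`C₀, C₁` (printed TYPE: analyticity of the minimiser in the background field, [Balaban1985Variational] Sect. G
Prop. 9 p. 309, expansion (172)–(177) pp. 305–306 — the located INSTANCE, i.e. the order-3 Cauchy constants along
two-speed rays, is NOT printed); (SM₂) as above; (TS) the two-speed presentation of the live-level lattice field in an
axial gauge (harmonic/holonomy coordinates at weight 1, the rest at weight 2) as a measurable polar-type fibration
`Ω → Y × ℝ` with density — a CONSTRUCTION binder, not discharged here; (DC-fwd) of phase-space size
`B = n_fl + n_h/2` in the degree-2 clock (`T4ShellMeasureAnalytic` §8 with `n ↦ (2n_fl + n_h)/2`); (SS′), (GOOD′),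
(W1), (F∞)-rate as for every NE7c member.  NOT PRINTED anywhere in B11/B12/B14/B15: any modulus of almost-commuting
holonomies, any rate statement along a dilation, (SM)/(SM₂), (DC-fwd), (SS′).  Literature presearch (corpus
fts + hybrid AND galaxy, 2026-08-19): "almost commuting matrices are near commuting pairs" → corpus: only general
matrix-analysis texts [corpus:book:horn2012-matrix-analysis p.275] (commuting families, no modulus), galaxy:
[galaxy:pdf:2824834700] (Loring 2015, pseudospectra/almost-commuting in OPERATOR norm, large `N`) — the classical
almost-commuting-vs-nearly-commuting results (Lin 1997; Hastings 2009) live in that regime, with dimension-free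
Hölder-type moduli, and are NOT imported; the rank-one computation of §1 (pairs in `su(2) ≅ (ℝ³, ×)`, exact exponent
`1/2` at `0`) is elementary and uncited; "Lojasiewicz commuting matrices" (corpus) / "commuting variety|Lojasiewicz
inequality for commut" (galaxy): no relevant hits; "toron gauge torus" → torons = constant (flat) modes of the gauge
field on the torus are classical in lattice gauge theory [corpus:book:greensite2011-introduction-confinement-problem
p.46], [corpus:paper:arxiv-hep-lat_9912021 p.12] — cited for the WORD only, nothing is imported.

ABSOLUTE RULE.  No internally-minted statement is a cited fact; every hypothesis is a binder; nothing of
[Balaban 1983–89] is instantiated or quoted as authority for a disputed step; all docstrings [folklore]; 0 sorry.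

(value: the one located input of (γ″) that was a question of pure mathematics — the modulus behind the toron caveat
— is now a kernel fact with the exponent decided (1/2, sharp), the consequence for (γ″) is typed as a negative
(the bad-toron band is outside its scope), and the repair (γ‴) is kernel-complete down to
`T4ShellMeasureAnalytic.FibreAlternative` BY NAME modulo (AN-inst₂), (SM₂), (TS), (DC-fwd), (SS′), (GOOD′); what a
referee must be shown for the toron sector is exactly: the order-3 Cauchy constants along two-speed rays and
`θ_j^{1/2} ≲ s`.  NOT summit progress.)
-/

namespace Literature.MathematicalPhysics.QuantumFieldTheory.Balaban1983to89.T4ShellMeasureToron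

open MeasureTheory Set Matrix
open scoped NNReal ENNReal RealInnerProductSpace

open Literature.MathematicalPhysics.QuantumFieldTheory.Balaban1983to89.T4ShellMeasureFibre (TwoSidedBelow)
open Literature.MathematicalPhysics.QuantumFieldTheory.Balaban1983to89.T4ShellMeasureAnalytic

/-! ## §1 Commutator-defect geometry in `su(2) ≅ (ℝ³, ×)`: the distance to the commuting pairs is Hölder-1/2 in the
commutator, and the exponent is sharp at the flat point

Dictionary.  For `G = SU(2)` the Lie algebra with its invariant inner product is `(ℝ³, ·)` and the bracket is the
cross product; two generators commute iff they are linearly dependent, i.e. iff `a × b = 0`.  The linearised flat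
(toron) locus for a pair of holonomy generators is the cone of dependent pairs; `D² = |a − a′|² + |b − b′|²` is the
squared `ℓ²`-distance to a point of it.  All statements are in terms of `⬝ᵥ` (sums of squares), no norm instance on
`Fin 3 → ℝ` is used. -/

section CrossGeometry

/-  Reused from Mathlib rather than restated (the gate's dedup found these as landed elsewhere in `Literature`):
    `0 ≤ v ⬝ᵥ v` is `Matrix.dotProduct_star_self_nonneg` with the trivial star; Lagrange's identity is
    `Matrix.cross_dot_cross`; `|a × b|² = |b × a|²` is `cross_anticomm` + `neg_dotProduct`/`dotProduct_neg`. -/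

/-- expansion of `|a − c b|²`. [folklore] -/
theorem dotProduct_self_sub_smul (a b : Fin 3 → ℝ) (c : ℝ) :
    (a - c • b) ⬝ᵥ (a - c • b) = a ⬝ᵥ a - 2 * c * (a ⬝ᵥ b) + c ^ 2 * (b ⬝ᵥ b) := by
  simp only [sub_dotProduct, dotProduct_sub, dotProduct_smul, smul_dotProduct, smul_eq_mul, dotProduct_comm b a]
  ring

/-- THE UPPER BOUND, case `|a| ≤ |b|`: projecting `a` onto the line of `b` gives a commuting pair at squared distance
`D²` with `D²·|b|² = |a × b|²` (hence `D²·max(|a|²,|b|²) ≤ |a × b|²`) and `D⁴ ≤ |a × b|²`. [folklore] -/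
theorem exists_commuting_near_of_le {a b : Fin 3 → ℝ} (hab : a ⬝ᵥ a ≤ b ⬝ᵥ b) :
    ∃ a' b' : Fin 3 → ℝ, a' ⨯₃ b' = 0 ∧
      ((a - a') ⬝ᵥ (a - a') + (b - b') ⬝ᵥ (b - b')) * max (a ⬝ᵥ a) (b ⬝ᵥ b) ≤ (a ⨯₃ b) ⬝ᵥ (a ⨯₃ b) ∧
      ((a - a') ⬝ᵥ (a - a') + (b - b') ⬝ᵥ (b - b')) ^ 2 ≤ (a ⨯₃ b) ⬝ᵥ (a ⨯₃ b) := by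
  have hnn : ∀ v : Fin 3 → ℝ, 0 ≤ v ⬝ᵥ v := fun v => by simpa using dotProduct_star_self_nonneg v
  have hlag : (a ⨯₃ b) ⬝ᵥ (a ⨯₃ b) = (a ⬝ᵥ a) * (b ⬝ᵥ b) - (a ⬝ᵥ b) ^ 2 := by
    rw [cross_dot_cross, dotProduct_comm b a]; ring
  have hS : 0 ≤ (a ⨯₃ b) ⬝ᵥ (a ⨯₃ b) := hnn _
  rw [max_eq_right hab]
  rcases (hnn b).eq_or_lt with hb | hb
  · -- `b = 0`, hence `a = 0`: the pair already commutes
    have ha : a ⬝ᵥ a = 0 := le_antisymm (hb ▸ hab) (hnn a)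
    refine ⟨0, 0, by simp, ?_, ?_⟩
    · rw [← hb]; simpa using hS
    · simp only [sub_zero, ha, ← hb, add_zero]
      simpa using hS
  · -- project `a` onto the line of `b`
    set c : ℝ := a ⬝ᵥ b / b ⬝ᵥ b with hc
    have hcb : c * (b ⬝ᵥ b) = a ⬝ᵥ b := by rw [hc]; field_simp
    have hD : (a - c • b) ⬝ᵥ (a - c • b) * (b ⬝ᵥ b) = (a ⨯₃ b) ⬝ᵥ (a ⨯₃ b) := by
      rw [dotProduct_self_sub_smul, hlag]
      linear_combination (c * (b ⬝ᵥ b) - a ⬝ᵥ b) * hcb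
    refine ⟨c • b, b, ?_, ?_, ?_⟩
    · rw [LinearMap.map_smul, LinearMap.smul_apply, cross_self, smul_zero]
    · rw [sub_self, show (0 : Fin 3 → ℝ) ⬝ᵥ 0 = 0 by simp, add_zero, hD]
    · rw [sub_self, show (0 : Fin 3 → ℝ) ⬝ᵥ 0 = 0 by simp, add_zero]
      have hDeq : (a - c • b) ⬝ᵥ (a - c • b) = (a ⨯₃ b) ⬝ᵥ (a ⨯₃ b) / (b ⬝ᵥ b) :=
        eq_div_of_mul_eq hb.ne' hD
      have hS1 : (a ⨯₃ b) ⬝ᵥ (a ⨯₃ b) ≤ (b ⬝ᵥ b) ^ 2 := by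
        rw [hlag]; nlinarith [sq_nonneg (a ⬝ᵥ b), hnn a]
      rw [hDeq, div_pow, div_le_iff₀ (pow_pos hb 2)]
      nlinarith

/-- **DISTANCE TO THE COMMUTING PAIRS ≤ |COMMUTATOR|^{1/2}.**  For every pair `(a, b)` in `ℝ³` there is a commuting
(dependent) pair `(a′, b′)` with `D²·max(|a|², |b|²) ≤ |a × b|²` (Lipschitz-type AWAY from `0`) and `D⁴ ≤ |a × b|²`
(Hölder-1/2, uniform). [folklore] -/
theorem exists_commuting_near (a b : Fin 3 → ℝ) :
    ∃ a' b' : Fin 3 → ℝ, a' ⨯₃ b' = 0 ∧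
      ((a - a') ⬝ᵥ (a - a') + (b - b') ⬝ᵥ (b - b')) * max (a ⬝ᵥ a) (b ⬝ᵥ b) ≤ (a ⨯₃ b) ⬝ᵥ (a ⨯₃ b) ∧
      ((a - a') ⬝ᵥ (a - a') + (b - b') ⬝ᵥ (b - b')) ^ 2 ≤ (a ⨯₃ b) ⬝ᵥ (a ⨯₃ b) := by
  rcases le_total (a ⬝ᵥ a) (b ⬝ᵥ b) with h | h
  · exact exists_commuting_near_of_le h
  · obtain ⟨b', a', hd, h1, h2⟩ := exists_commuting_near_of_le h
    have hcomm : (a ⨯₃ b) ⬝ᵥ (a ⨯₃ b) = (b ⨯₃ a) ⬝ᵥ (b ⨯₃ a) := by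
      rw [← cross_anticomm b a, neg_dotProduct, dotProduct_neg, neg_neg]
    refine ⟨a', b', ?_, ?_, ?_⟩
    · rw [← cross_anticomm, hd, neg_zero]
    · rw [max_comm, add_comm, hcomm]; exact h1
    · rw [add_comm, hcomm]; exact h2

/-- the model toron pair `a = t e₀`, `b = t e₁`: its commutator is `t² e₂`. [folklore] -/
theorem cross_model (t : ℝ) : ![t, 0, 0] ⨯₃ ![0, t, 0] = ![0, 0, t ^ 2] := by
  rw [cross_apply]
  ext i; fin_cases i <;> simp [sq]

/-- … of squared size `t⁴`. [folklore] -/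
theorem cross_model_dot (t : ℝ) : (![t, 0, 0] ⨯₃ ![0, t, 0]) ⬝ᵥ (![t, 0, 0] ⨯₃ ![0, t, 0]) = (t ^ 2) ^ 2 := by
  rw [cross_model, vec3_dotProduct]; simp; ring

/-- **SHARPNESS OF THE EXPONENT 1/2 AT THE FLAT POINT.**  Every commuting pair is at squared distance `≥ t²`
`= |a × b|` from the model pair `(t e₀, t e₁)`: with `x = a′`, `y = b′` and the minor relation `x₀y₁ = x₁y₀`,
`D² − t² = (t − x₀ − y₁)² + (x₁ − y₀)² + x₂² + y₂² ≥ 0`. [folklore] -/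
theorem sq_le_sqDist_of_commuting (t : ℝ) {a' b' : Fin 3 → ℝ} (h : a' ⨯₃ b' = 0) :
    t ^ 2 ≤ (![t, 0, 0] - a') ⬝ᵥ (![t, 0, 0] - a') + (![0, t, 0] - b') ⬝ᵥ (![0, t, 0] - b') := by
  have h2 : a' 0 * b' 1 - a' 1 * b' 0 = 0 := by
    have := congr_fun h 2
    rw [cross_apply] at this
    simpa using this
  rw [vec3_dotProduct, vec3_dotProduct]
  simp only [Pi.sub_apply, Matrix.cons_val_zero, Matrix.cons_val_one, Matrix.head_cons, Matrix.cons_val_two,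
    Matrix.tail_cons]
  nlinarith [sq_nonneg (t - a' 0 - b' 1), sq_nonneg (a' 1 - b' 0), sq_nonneg (a' 2), sq_nonneg (b' 2), h2]

/-- … so on the model family the Hölder-1/2 bound of `exists_commuting_near` is ATTAINED: the infimum of `D²` over
commuting pairs is exactly `|a × b| = t²` (upper bound: the commuting pair `(0, t e₁)`). [folklore] -/
theorem sqDist_model_attained (t : ℝ) :
    (∀ a' b' : Fin 3 → ℝ, a' ⨯₃ b' = 0 →
      ((t ^ 2) ^ 2 : ℝ) ≤ ((![t, 0, 0] - a') ⬝ᵥ (![t, 0, 0] - a') + (![0, t, 0] - b') ⬝ᵥ (![0, t, 0] - b')) ^ 2) ∧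
    ∃ a' b' : Fin 3 → ℝ, a' ⨯₃ b' = 0 ∧
      (![t, 0, 0] - a') ⬝ᵥ (![t, 0, 0] - a') + (![0, t, 0] - b') ⬝ᵥ (![0, t, 0] - b') = t ^ 2 := by
  refine ⟨fun a' b' h => pow_le_pow_left₀ (sq_nonneg t) (sq_le_sqDist_of_commuting t h) 2, 0, ![0, t, 0], ?_, ?_⟩
  · simp
  · simp [sq]

/-- **NOT LIPSCHITZ.**  No constant `C` makes `D² ≤ C·|a × b|²` achievable by commuting pairs for all `(a, b)`
("almost-commuting ⇒ near-commuting" in `su(2)` has no linear modulus at the flat point). [folklore] -/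
theorem not_lipschitz_modulus : ¬ ∃ C : ℝ, ∀ a b : Fin 3 → ℝ, ∃ a' b' : Fin 3 → ℝ, a' ⨯₃ b' = 0 ∧
    (a - a') ⬝ᵥ (a - a') + (b - b') ⬝ᵥ (b - b') ≤ C * ((a ⨯₃ b) ⬝ᵥ (a ⨯₃ b)) := by
  rintro ⟨C, hC⟩
  set t : ℝ := 1 / (|C| + 1) with ht
  have ht0 : 0 < t := by rw [ht]; positivity
  have ht1 : |C| * t ^ 2 < 1 := by
    have h1 : t ≤ 1 := by
      rw [ht, div_le_one (by positivity)]; linarith [abs_nonneg C]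
    have h2 : |C| * t < 1 := by
      rw [ht, mul_one_div, div_lt_one (by positivity)]; linarith
    calc |C| * t ^ 2 = (|C| * t) * t := by ring
      _ ≤ |C| * t := by
          have : 0 ≤ |C| * t := by positivity
          nlinarith
      _ < 1 := h2
  obtain ⟨a', b', hd, hle⟩ := hC ![t, 0, 0] ![0, t, 0]
  have hlow := sq_le_sqDist_of_commuting t hd
  rw [cross_model_dot] at hle
  have hCt : C * (t ^ 2) ^ 2 ≤ |C| * t ^ 2 * t ^ 2 := by nlinarith [le_abs_self C, sq_nonneg t]
  have : t ^ 2 ≤ |C| * t ^ 2 * t ^ 2 := hlow.trans (hle.trans hCt)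
  nlinarith [pow_pos ht0 2]

end CrossGeometry

/-! ## §2 Toron rays are NON-TRANSVERSAL: the group commutator of two one-parameter subgroups is flat to first
order at the identity

Dictionary.  The plaquette variable of a UNIFORM (toron-type) lattice configuration `U_μ = e^{zA}`, `U_ν = e^{zB}`
is the group commutator `e^{zA}e^{zB}e^{−zA}e^{−zB}`; as a function of the ray parameter `z` it is `1 + z²[A, B] +
O(z³)`.  The kernel fact recorded here is the first-order part: value `1` and derivative `0` at `z = 0`, in any
complete normed algebra over `ℝ` or `ℂ` (so for `M_N(ℂ) ⊇ G`); i.e. in the vocabulary of `T4ShellMeasureAnalytic` §3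
the near-linear coefficient `a_p = h_p′(0)` of `h_p(z) = (commutator) − 1` VANISHES — a toron ray through the flat
point is a NON-TRANSVERSAL direction for every plaquette.  (That the minimiser of a uniform background is itself
uniform — so that the model applies to `U_k(V)` and not only to `V` — is a READING, located input (GOOD′), not a
kernel statement.) -/

section CommutatorPath

open NormedSpace

variable {𝕂 𝔸 : Type*} [RCLike 𝕂] [NormedRing 𝔸] [NormedAlgebra 𝕂 𝔸] [CompleteSpace 𝔸]

/-- THE COMMUTATOR PATH of the one-parameter subgroups through `A` and `B`. [folklore] -/
noncomputable def commPath (A B : 𝔸) (z : 𝕂) : 𝔸 :=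
  exp (z • A) * exp (z • B) * exp (z • -A) * exp (z • -B)

omit [CompleteSpace 𝔸] in
/-- at `z = 0` the commutator path is at the identity. [folklore] -/
theorem commPath_zero (A B : 𝔸) : commPath A B (0 : 𝕂) = 1 := by
  simp [commPath]

/-- each factor `z ↦ e^{zX}` has derivative `X` at `0`. [folklore] -/
theorem hasDerivAt_exp_smul_zero (X : 𝔸) : HasDerivAt (fun u : 𝕂 => exp (u • X)) X 0 := by
  simpa using hasDerivAt_exp_smul_const X (0 : 𝕂)

/-- **TORON RAYS ARE NON-TRANSVERSAL**: the commutator path has derivative `A + B − A − B = 0` at `z = 0`.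
[folklore] -/
theorem hasDerivAt_commPath_zero (A B : 𝔸) : HasDerivAt (commPath A B : 𝕂 → 𝔸) 0 0 := by
  have h := (((hasDerivAt_exp_smul_zero (𝕂 := 𝕂) A).mul (hasDerivAt_exp_smul_zero B)).mul
    (hasDerivAt_exp_smul_zero (-A))).mul (hasDerivAt_exp_smul_zero (-B))
  simp only [Pi.mul_apply, zero_smul, exp_zero, mul_one, one_mul] at h
  have hf : (commPath A B : 𝕂 → 𝔸) =
      ((((fun u : 𝕂 => exp (u • A)) * fun u => exp (u • B)) * fun u => exp (u • -A)) * fun u => exp (u • -B)) := by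
    funext z; simp only [commPath, Pi.mul_apply]
  rw [hf]
  convert h using 1
  abel

/-- THE DERIVATIVE OF THE COMMUTATOR PATH at a general point (product rule, term by term). [folklore] -/
noncomputable def commPathDeriv (A B : 𝔸) (u : 𝕂) : 𝔸 :=
  ((exp (u • A) * A * exp (u • B) + exp (u • A) * (exp (u • B) * B)) * exp (u • -A) +
      exp (u • A) * exp (u • B) * (exp (u • -A) * -A)) * exp (u • -B) +
    exp (u • A) * exp (u • B) * exp (u • -A) * (exp (u • -B) * -B)

/-- the commutator path is differentiable everywhere with derivative `commPathDeriv`. [folklore] -/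
theorem hasDerivAt_commPath (A B : 𝔸) (u : 𝕂) : HasDerivAt (commPath A B) (commPathDeriv A B u) u := by
  have d : ∀ X : 𝔸, HasDerivAt (fun v : 𝕂 => exp (v • X)) (exp (u • X) * X) u := fun X =>
    hasDerivAt_exp_smul_const X u
  have total := (((d A).mul (d B)).mul (d (-A))).mul (d (-B))
  have hf : (commPath A B : 𝕂 → 𝔸) =
      ((((fun v : 𝕂 => exp (v • A)) * fun v => exp (v • B)) * fun v => exp (v • -A)) * fun v => exp (v • -B)) := by
    funext z; simp only [commPath, Pi.mul_apply]
  rw [hf]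
  convert total using 1
  simp only [commPathDeriv, Pi.mul_apply]

/-- **THE SECOND-ORDER TERM IS THE COMMUTATOR**: `commPathDeriv` has derivative `2(AB − BA)` at `0`, i.e. the
commutator path is `1 + z²[A, B] + o(z²)` — in the vocabulary of §4 the degree-`2` coefficient of the toron
plaquette deviation is the Lie bracket of the two holonomy generators (for `su(2)`: the cross product of §1).
[folklore] -/
theorem hasDerivAt_commPathDeriv_zero (A B : 𝔸) :
    HasDerivAt (commPathDeriv A B : 𝕂 → 𝔸) ((2 : ℕ) • (A * B - B * A)) 0 := by
  have d : ∀ X : 𝔸, HasDerivAt (fun v : 𝕂 => exp (v • X)) X 0 := hasDerivAt_exp_smul_zero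
  have total :=
    (((((((d A).mul_const A).mul (d B)).add ((d A).mul ((d B).mul_const B))).mul (d (-A))).add
        (((d A).mul (d B)).mul ((d (-A)).mul_const (-A)))).mul (d (-B))).add
      ((((d A).mul (d B)).mul (d (-A))).mul ((d (-B)).mul_const (-B)))
  simp only [Pi.mul_apply, Pi.add_apply, zero_smul, exp_zero, one_mul, mul_one] at total
  have hf : (commPathDeriv A B : 𝕂 → 𝔸) = fun u : 𝕂 =>
      ((exp (u • A) * A * exp (u • B) + exp (u • A) * (exp (u • B) * B)) * exp (u • -A) +
          exp (u • A) * exp (u • B) * (exp (u • -A) * -A)) * exp (u • -B) +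
        exp (u • A) * exp (u • B) * exp (u • -A) * (exp (u • -B) * -B) := rfl
  rw [hf]
  convert total using 1 <;> first | rfl | noncomm_ring

/-- … so the tested deviation `h(z) = commutator − 1` vanishes at `0` together with its derivative: its near-linear
coefficient in the sense of `T4ShellMeasureAnalytic` §3 is `a = 0`. [folklore] -/
theorem hasDerivAt_commPath_sub_one_zero (A B : 𝔸) :
    (fun z : 𝕂 => commPath A B z - 1) 0 = 0 ∧ HasDerivAt (fun z : 𝕂 => commPath A B z - 1) 0 0 := by
  refine ⟨by simp [commPath_zero], ?_⟩
  simpa using (hasDerivAt_commPath_zero (𝕂 := 𝕂) A B).sub_const (1 : 𝔸)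

end CommutatorPath

/-! ## §3 A typed NEGATIVE for member (γ″): under (SM) a purely quadratic direction never reaches the shell — so a
fibre on which one DOES is outside the scope of (γ″)

Dictionary.  On a toron ray (§2) every plaquette functional has `a_p = 0`, i.e. `‖h_p z‖ ≤ C₀z²` on the physical
range `(0, x₀]` ((AN-inst) with `a = 0`).  `T4ShellMeasureAnalytic.norm_lt_of_nonTransversal` then says: IF (SM)
holds, the direction never reaches `lo = θ(1 − ρ)`.  In the BAD-TORON BAND the commutators do reach `lo` within the
physical range (that is what defines the band), hence (SM) is FALSE there — for every `s < 1`, whatever `C₁ ≥ 0`.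
Nothing here is a statement about the densities; it is the typed form of the objection GAPS G-ne7cp1-11b. -/

section Negative

variable {E : Type*} [NormedAddCommGroup E]

/-- under (SM) with `s < 1` the zero direction is NON-TRANSVERSAL: `‖0‖ < lo/x₀ − C₀x₀`. [folklore] -/
theorem nonTransversal_zero_of_SM {C₀ C₁ s lo x₀ : ℝ} (hC₁ : 0 ≤ C₁) (hs : s < 1) (hlo : 0 < lo)
    (hx₀ : 0 < x₀) (hSM : (C₀ + C₁) * x₀ ^ 2 ≤ s * lo) : ‖(0 : E)‖ < lo / x₀ - C₀ * x₀ := by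
  rw [norm_zero, lt_sub_iff_add_lt, zero_add, lt_div_iff₀ hx₀]
  nlinarith

variable [NormedSpace ℝ E]

/-- … hence under (SM) a purely quadratic direction (`‖h z‖ ≤ C₀z²` on `(0, x₀]`) never reaches the level `lo` on
the physical range (`T4ShellMeasureAnalytic.norm_lt_of_nonTransversal` with `a = 0`). [folklore] -/
theorem quadratic_lt_of_SM {h : ℝ → E} {C₀ C₁ s lo x₀ : ℝ} (hC₀ : 0 ≤ C₀) (hC₁ : 0 ≤ C₁) (hs : s < 1)
    (hlo : 0 < lo) (hx₀ : 0 < x₀) (hSM : (C₀ + C₁) * x₀ ^ 2 ≤ s * lo)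
    (h0 : ∀ z ∈ Ioc 0 x₀, ‖h z‖ ≤ C₀ * z ^ 2) {z : ℝ} (hz : z ∈ Ioc 0 x₀) : ‖h z‖ < lo :=
  norm_lt_of_nonTransversal (a := (0 : E)) hC₀ hx₀ (nonTransversal_zero_of_SM hC₁ hs hlo hx₀ hSM) hz
    (by simpa using h0 z hz)

omit [NormedSpace ℝ E] in
/-- **THE TYPED NEGATIVE.**  A purely quadratic direction that REACHES the level `lo > 0` somewhere on the physical
range `(0, x₀]` is incompatible with (SM) for every `s < 1` and every `C₁ ≥ 0`: `lo ≤ ‖h z‖ ≤ C₀z² ≤ C₀x₀²` while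
(SM) gives `C₀x₀² ≤ s·lo < lo`. [folklore] -/
theorem not_SM_of_quadratic_reach {h : ℝ → E} {C₀ C₁ s lo x₀ : ℝ} (hC₁ : 0 ≤ C₁) (hs : s < 1) (hlo : 0 < lo)
    (h0 : ∀ z ∈ Ioc 0 x₀, ‖h z‖ ≤ C₀ * z ^ 2) (hreach : ∃ z ∈ Ioc 0 x₀, lo ≤ ‖h z‖) :
    ¬ (C₀ + C₁) * x₀ ^ 2 ≤ s * lo := by
  obtain ⟨z, hz, hlz⟩ := hreach
  intro hSM
  have h1 : lo ≤ C₀ * z ^ 2 := hlz.trans (h0 z hz)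
  have hC₀ : 0 < C₀ := by
    by_contra hC
    rw [not_lt] at hC
    nlinarith [sq_nonneg z]
  have h2 : C₀ * z ^ 2 ≤ C₀ * x₀ ^ 2 := mul_le_mul_of_nonneg_left (by nlinarith [hz.1, hz.2]) hC₀.le
  nlinarith [sq_nonneg x₀]

omit [NormedSpace ℝ E] in
/-- The same in the model terms of the bad-toron band: if the quadratic coefficient is ATTAINED up to the remainder,
`κ z² ≤ ‖h z‖ ≤ C₀ z²` on `(0, x₀]` with `κ x₀² ≥ lo` (the commutator reaches the shell within the physical range),
then (SM) fails, whatever the bookkeeping constant `C₀` (necessarily `≥ κ`). [folklore] -/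
theorem not_SM_of_commutator_reach {h : ℝ → E} {κ C₀ C₁ s lo x₀ : ℝ} (hC₁ : 0 ≤ C₁) (hs : s < 1) (hlo : 0 < lo)
    (hx₀ : 0 < x₀) (hlow : ∀ z ∈ Ioc 0 x₀, κ * z ^ 2 ≤ ‖h z‖)
    (h0 : ∀ z ∈ Ioc 0 x₀, ‖h z‖ ≤ C₀ * z ^ 2) (hreach : lo ≤ κ * x₀ ^ 2) :
    ¬ (C₀ + C₁) * x₀ ^ 2 ≤ s * lo :=
  not_SM_of_quadratic_reach hC₁ hs hlo h0 ⟨x₀, ⟨hx₀, le_rfl⟩, hreach.trans (hlow x₀ ⟨hx₀, le_rfl⟩)⟩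

end Negative

/-! ## §4 REPAIR, member (γ‴): NEAR-HOMOGENEOUS profiles of degree `m` (the toron sector is `m = 2` along
two-speed rays)

Dictionary.  Along a two-speed ray of a good live level (holonomy/harmonic modes at weight `z`, fluctuation modes at
weight `z²`; located construction input (TS)) every plaquette functional of the minimiser is — GIVEN analyticity,
(AN-inst₂) — near-homogeneous of degree `2`: `‖h_p(z) − z²b_p‖ ≤ C₀z³`, `‖h_p′(z) − 2z b_p‖ ≤ C₁z²`.  Read in the
clock `z = e^{−r/2}` the norm profile then runs at unit rate up to a relative Euler defect, exactly as in
`T4ShellMeasureAnalytic` §3 (which is the case `m = 1`, clock `z = e^{−r}`).  Everything below is for general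
`m ≥ 1`; nothing but the clock and the powers changes. -/

section NearHomogeneous

variable {E : Type*} [NormedAddCommGroup E]

/-- THE DEGREE-`m` NORM PROFILE along one fibre: `‖h(e^{−r/m})‖` on the physical tail `r ≥ r₀`, extended at unit
rate below `r₀`. [folklore] -/
noncomputable def normProfileDeg (m : ℕ) (h : ℝ → E) (r₀ : ℝ) (r : ℝ) : ℝ :=
  ‖h (Real.exp (-(max r r₀) / m))‖ * Real.exp (max r r₀ - r)

/-- `m = 1` is the norm profile of `T4ShellMeasureAnalytic` §3. [folklore] -/
theorem normProfileDeg_one (h : ℝ → E) (r₀ : ℝ) : normProfileDeg 1 h r₀ = normProfile h r₀ := by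
  funext r; simp [normProfileDeg, normProfile]

/-- on the physical tail the profile is `‖h(e^{−r/m})‖`. [folklore] -/
theorem normProfileDeg_of_le {m : ℕ} {h : ℝ → E} {r₀ r : ℝ} (hr : r₀ ≤ r) :
    normProfileDeg m h r₀ r = ‖h (Real.exp (-r / m))‖ := by
  simp [normProfileDeg, max_eq_left hr]

/-- the evaluation point `e^{−max(r, r₀)/m}` lies in the physical range `(0, e^{−r₀/m}]`. [folklore] -/
theorem exp_neg_max_div_mem {m : ℕ} (hm : 0 < m) {r₀ : ℝ} (r : ℝ) :
    Real.exp (-(max r r₀) / m) ∈ Ioc 0 (Real.exp (-r₀ / m)) := by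
  have hm' : (0 : ℝ) < m := Nat.cast_pos.2 hm
  exact ⟨Real.exp_pos _, Real.exp_le_exp.2
    (div_le_div_of_nonneg_right (neg_le_neg (le_max_right _ _)) hm'.le)⟩

/-- on the physical tail the evaluation point `e^{−r/m}` lies in the physical range. [folklore] -/
theorem exp_neg_div_mem {m : ℕ} (hm : 0 < m) {r₀ r : ℝ} (hr : r₀ ≤ r) :
    Real.exp (-r / m) ∈ Ioc 0 (Real.exp (-r₀ / m)) := by
  have := exp_neg_max_div_mem hm (r₀ := r₀) r
  rwa [max_eq_left hr] at this

/-- the profile is continuous as soon as `h` is continuous at every point of the physical range. [folklore] -/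
theorem continuous_normProfileDeg {m : ℕ} (hm : 0 < m) {h : ℝ → E} {r₀ : ℝ}
    (hc : ∀ z ∈ Ioc 0 (Real.exp (-r₀ / m)), ContinuousAt h z) : Continuous (normProfileDeg m h r₀) := by
  have h1 : Continuous fun r : ℝ => Real.exp (-(max r r₀) / m) := by fun_prop
  have h2 : Continuous fun r : ℝ => h (Real.exp (-(max r r₀) / m)) :=
    continuous_iff_continuousAt.2 fun r =>
      ContinuousAt.comp (g := h) (f := fun r : ℝ => Real.exp (-(max r r₀) / m)) (x := r)
        (hc _ (exp_neg_max_div_mem hm r)) h1.continuousAt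
  have h3 : Continuous fun r : ℝ => Real.exp (max r r₀ - r) := by fun_prop
  unfold normProfileDeg
  exact h2.norm.mul h3

/-- on a fibre where `h` does not vanish on the physical range, `log ∘ normProfileDeg m` is the unit-rate extension
of the tail log-profile `r ↦ ½ log ‖h(e^{−r/m})‖²`. [folklore] -/
theorem log_normProfileDeg_eq {m : ℕ} (hm : 0 < m) {h : ℝ → E} {r₀ : ℝ}
    (hne : ∀ z ∈ Ioc 0 (Real.exp (-r₀ / m)), h z ≠ 0) (r : ℝ) :
    Real.log (normProfileDeg m h r₀ r) =
      tailExtend (fun r => (2 : ℝ)⁻¹ * Real.log (‖h (Real.exp (-r / m))‖ ^ 2)) r₀ r := by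
  have hpos : 0 < ‖h (Real.exp (-(max r r₀) / m))‖ := norm_pos_iff.2 (hne _ (exp_neg_max_div_mem hm r))
  rw [normProfileDeg, tailExtend, Real.log_mul hpos.ne' (Real.exp_pos _).ne', Real.log_exp, Real.log_pow]
  push_cast
  ring

section Smul

variable [NormedSpace ℝ E]

/-- NON-TRANSVERSAL DEGREE-`m` DIRECTIONS NEVER REACH THE SHELL ON THE PHYSICAL RANGE:
`‖b‖ < lo/x₀^m − C₀x₀` and `‖h z − z^m • b‖ ≤ C₀z^{m+1}` give `‖h z‖ < lo` for `z ∈ (0, x₀]`. [folklore] -/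
theorem norm_lt_of_nonTransversalDeg {m : ℕ} {h : ℝ → E} {b : E} {C₀ lo x₀ z : ℝ} (hC₀ : 0 ≤ C₀) (hx₀ : 0 < x₀)
    (hb : ‖b‖ < lo / x₀ ^ m - C₀ * x₀) (hz : z ∈ Ioc 0 x₀) (h0 : ‖h z - z ^ m • b‖ ≤ C₀ * z ^ (m + 1)) :
    ‖h z‖ < lo := by
  obtain ⟨hz0, hzx⟩ := hz
  have hxm : 0 < x₀ ^ m := pow_pos hx₀ m
  have hzb : ‖z ^ m • b‖ = z ^ m * ‖b‖ := by rw [norm_smul, Real.norm_eq_abs, abs_of_pos (pow_pos hz0 m)]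
  have h1 : ‖h z‖ ≤ z ^ m * ‖b‖ + C₀ * z ^ (m + 1) := by
    calc ‖h z‖ = ‖z ^ m • b + (h z - z ^ m • b)‖ := by rw [add_sub_cancel]
      _ ≤ ‖z ^ m • b‖ + ‖h z - z ^ m • b‖ := norm_add_le _ _
      _ ≤ z ^ m * ‖b‖ + C₀ * z ^ (m + 1) := by rw [hzb]; exact add_le_add le_rfl h0
  have hzm : z ^ m ≤ x₀ ^ m := pow_le_pow_left₀ hz0.le hzx m
  have h2 : z ^ m * ‖b‖ ≤ x₀ ^ m * ‖b‖ := mul_le_mul_of_nonneg_right hzm (norm_nonneg _)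
  have h3 : C₀ * z ^ (m + 1) ≤ C₀ * x₀ ^ (m + 1) :=
    mul_le_mul_of_nonneg_left (pow_le_pow_left₀ hz0.le hzx (m + 1)) hC₀
  have h4 : x₀ ^ m * ‖b‖ < x₀ ^ m * (lo / x₀ ^ m - C₀ * x₀) := mul_lt_mul_of_pos_left hb hxm
  have h5 : x₀ ^ m * (lo / x₀ ^ m - C₀ * x₀) = lo - C₀ * x₀ ^ (m + 1) := by
    field_simp
    ring
  linarith

/-- A NON-TRANSVERSAL degree-`m` direction never reaches the level `lo` on the physical tail. [folklore] -/
theorem normProfileDeg_lt_of_nonTransversal {m : ℕ} (hm : 0 < m) {h : ℝ → E} {b : E} {C₀ r₀ lo : ℝ}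
    (hC₀ : 0 ≤ C₀) (h0 : ∀ z ∈ Ioc 0 (Real.exp (-r₀ / m)), ‖h z - z ^ m • b‖ ≤ C₀ * z ^ (m + 1))
    (hb : ‖b‖ < lo / Real.exp (-r₀ / m) ^ m - C₀ * Real.exp (-r₀ / m)) {r : ℝ} (hr : r₀ ≤ r) :
    normProfileDeg m h r₀ r < lo := by
  have hz := exp_neg_div_mem hm hr
  rw [normProfileDeg_of_le hr]
  exact norm_lt_of_nonTransversalDeg hC₀ (Real.exp_pos _) hb hz (h0 _ hz)

end Smul

section Inner

variable [InnerProductSpace ℝ E]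

/-- **NEAR-HOMOGENEITY OF DEGREE `m` ⇒ RELATIVE EULER DEFECT** (intensity `‖h‖²`, degree `2m`).  At `z > 0` with
`‖h z − z^m•b‖ ≤ C₀z^{m+1}`, `‖h′ z − (m z^{m−1})•b‖ ≤ C₁z^m` and `C₀z < ‖b‖`: `‖h z‖ ≥ z^m(‖b‖ − C₀z) > 0` and
`|m‖h z‖² − z⟨h z, h′ z⟩| ≤ ((C₀ + C₁/m)z/(‖b‖ − C₀z)) · m‖h z‖²`. [folklore] -/
theorem relEulerDefect_of_nearHomogeneous {m : ℕ} (hm : 0 < m) {h h' : ℝ → E} {b : E} {C₀ C₁ z : ℝ}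
    (hz : 0 < z) (h0 : ‖h z - z ^ m • b‖ ≤ C₀ * z ^ (m + 1))
    (h1 : ‖h' z - ((m : ℝ) * z ^ (m - 1)) • b‖ ≤ C₁ * z ^ m) (hb : C₀ * z < ‖b‖) :
    z ^ m * (‖b‖ - C₀ * z) ≤ ‖h z‖ ∧ 0 < ‖h z‖ ∧
      |(m : ℝ) * ‖h z‖ ^ 2 - z * ⟪h z, h' z⟫| ≤
        ((C₀ + C₁ / m) * z / (‖b‖ - C₀ * z)) * ((m : ℝ) * ‖h z‖ ^ 2) := by
  obtain ⟨k, rfl⟩ : ∃ k, m = k + 1 := ⟨m - 1, (Nat.succ_pred_eq_of_pos hm).symm⟩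
  have hm' : (0 : ℝ) < (k + 1 : ℕ) := Nat.cast_pos.2 hm
  have hzk : 0 < z ^ (k + 1) := pow_pos hz _
  have hC₀ : 0 ≤ C₀ := by
    have := (norm_nonneg _).trans h0
    exact (mul_nonneg_iff_of_pos_right (pow_pos hz (k + 1 + 1))).1 this
  have hC₁ : 0 ≤ C₁ := by
    have := (norm_nonneg _).trans h1
    exact (mul_nonneg_iff_of_pos_right hzk).1 this
  have hκ : 0 < ‖b‖ - C₀ * z := sub_pos.2 hb
  have hzb : ‖z ^ (k + 1) • b‖ = z ^ (k + 1) * ‖b‖ := by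
    rw [norm_smul, Real.norm_eq_abs, abs_of_pos hzk]
  have hlow : z ^ (k + 1) * (‖b‖ - C₀ * z) ≤ ‖h z‖ := by
    have h3 : ‖z ^ (k + 1) • b‖ ≤ ‖h z‖ + ‖h z - z ^ (k + 1) • b‖ := by
      calc ‖z ^ (k + 1) • b‖ = ‖h z - (h z - z ^ (k + 1) • b)‖ := by rw [sub_sub_cancel]
        _ ≤ ‖h z‖ + ‖h z - z ^ (k + 1) • b‖ := norm_sub_le _ _
    rw [hzb] at h3
    have e : z ^ (k + 1) * (‖b‖ - C₀ * z) = z ^ (k + 1) * ‖b‖ - C₀ * z ^ (k + 1 + 1) := by ring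
    linarith
  have hpos : 0 < ‖h z‖ := lt_of_lt_of_le (mul_pos hzk hκ) hlow
  refine ⟨hlow, hpos, ?_⟩
  -- the remainder `m h − z h′ = m (h − z^m b) − z (h′ − m z^{m−1} b)`
  have hid : ((k + 1 : ℕ) : ℝ) * ‖h z‖ ^ 2 - z * ⟪h z, h' z⟫ =
      ⟪h z, ((k + 1 : ℕ) : ℝ) • h z - z • h' z⟫ := by
    rw [inner_sub_right, inner_smul_right, inner_smul_right, real_inner_self_eq_norm_sq]
  have hR : ((k + 1 : ℕ) : ℝ) • h z - z • h' z =
      ((k + 1 : ℕ) : ℝ) • (h z - z ^ (k + 1) • b) - z • (h' z - (((k + 1 : ℕ) : ℝ) * z ^ (k + 1 - 1)) • b) := by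
    simp only [smul_sub, smul_smul, Nat.add_sub_cancel, pow_succ]
    have e : z * (((k + 1 : ℕ) : ℝ) * z ^ k) = ((k + 1 : ℕ) : ℝ) * (z ^ k * z) := by ring
    rw [e]
    abel
  have hrem : ‖((k + 1 : ℕ) : ℝ) • h z - z • h' z‖ ≤ (((k + 1 : ℕ) : ℝ) * C₀ + C₁) * z ^ (k + 1 + 1) := by
    rw [hR]
    calc ‖((k + 1 : ℕ) : ℝ) • (h z - z ^ (k + 1) • b) -
            z • (h' z - (((k + 1 : ℕ) : ℝ) * z ^ (k + 1 - 1)) • b)‖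
          ≤ ‖((k + 1 : ℕ) : ℝ) • (h z - z ^ (k + 1) • b)‖ +
            ‖z • (h' z - (((k + 1 : ℕ) : ℝ) * z ^ (k + 1 - 1)) • b)‖ := norm_sub_le _ _
      _ ≤ ((k + 1 : ℕ) : ℝ) * (C₀ * z ^ (k + 1 + 1)) + z * (C₁ * z ^ (k + 1)) := by
          rw [norm_smul, norm_smul, Real.norm_eq_abs, Real.norm_eq_abs, abs_of_pos hm', abs_of_pos hz]
          exact add_le_add (mul_le_mul_of_nonneg_left h0 hm'.le) (mul_le_mul_of_nonneg_left h1 hz.le)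
      _ = (((k + 1 : ℕ) : ℝ) * C₀ + C₁) * z ^ (k + 1 + 1) := by ring
  rw [hid]
  have hcs : |⟪h z, ((k + 1 : ℕ) : ℝ) • h z - z • h' z⟫| ≤ ‖h z‖ * ‖((k + 1 : ℕ) : ℝ) • h z - z • h' z‖ :=
    abs_real_inner_le_norm _ _
  have hc : 0 ≤ (C₀ + C₁ / ((k + 1 : ℕ) : ℝ)) * z / (‖b‖ - C₀ * z) := by positivity
  have key : ‖h z‖ * ‖((k + 1 : ℕ) : ℝ) • h z - z • h' z‖ ≤
      ((C₀ + C₁ / ((k + 1 : ℕ) : ℝ)) * z / (‖b‖ - C₀ * z)) * (((k + 1 : ℕ) : ℝ) * ‖h z‖ ^ 2) := by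
    calc ‖h z‖ * ‖((k + 1 : ℕ) : ℝ) • h z - z • h' z‖
          ≤ ‖h z‖ * ((((k + 1 : ℕ) : ℝ) * C₀ + C₁) * z ^ (k + 1 + 1)) :=
          mul_le_mul_of_nonneg_left hrem (norm_nonneg _)
      _ = ((C₀ + C₁ / ((k + 1 : ℕ) : ℝ)) * z / (‖b‖ - C₀ * z)) *
            (((k + 1 : ℕ) : ℝ) * (‖h z‖ * (z ^ (k + 1) * (‖b‖ - C₀ * z)))) := by
          field_simp
          ring
      _ ≤ ((C₀ + C₁ / ((k + 1 : ℕ) : ℝ)) * z / (‖b‖ - C₀ * z)) * (((k + 1 : ℕ) : ℝ) * (‖h z‖ * ‖h z‖)) := by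
          apply mul_le_mul_of_nonneg_left _ hc
          exact mul_le_mul_of_nonneg_left (mul_le_mul_of_nonneg_left hlow (norm_nonneg _)) hm'.le
      _ = ((C₀ + C₁ / ((k + 1 : ℕ) : ℝ)) * z / (‖b‖ - C₀ * z)) * (((k + 1 : ℕ) : ℝ) * ‖h z‖ ^ 2) := by ring
  exact hcs.trans key

/-- THE SMALLNESS RELATION (SM_m) and the TRANSVERSALITY THRESHOLD of degree `m`.  With `lo > 0`, `x₀ > 0`,
`(C₀ + C₁)x₀^{m+1} ≤ s·lo`, `0 ≤ s < 1/2`, `C₀, C₁ ≥ 0`, `m ≥ 1`: for a TRANSVERSAL direction,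
`‖b‖ ≥ lo/x₀^m − C₀x₀`, and every `z ∈ (0, x₀]`: `C₀z < ‖b‖` and `(C₀ + C₁/m)z/(‖b‖ − C₀z) ≤ s/(1 − 2s)`.
[folklore] -/
theorem defect_le_of_transversalDeg {m : ℕ} (hm : 0 < m) {C₀ C₁ s lo x₀ z nb : ℝ} (hC₀ : 0 ≤ C₀) (hC₁ : 0 ≤ C₁)
    (hs0 : 0 ≤ s) (hs : s < 1 / 2) (hlo : 0 < lo) (hx₀ : 0 < x₀) (hSM : (C₀ + C₁) * x₀ ^ (m + 1) ≤ s * lo)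
    (hnb : lo / x₀ ^ m - C₀ * x₀ ≤ nb) (hz : z ∈ Ioc 0 x₀) :
    C₀ * z < nb ∧ (C₀ + C₁ / m) * z / (nb - C₀ * z) ≤ s / (1 - 2 * s) := by
  obtain ⟨hz0, hzx⟩ := hz
  have hm' : (1 : ℝ) ≤ m := by exact_mod_cast hm
  have hm0 : (0 : ℝ) < m := by linarith
  have h12s : 0 < 1 - 2 * s := by linarith
  have hxm : 0 < x₀ ^ m := pow_pos hx₀ m
  -- `P = lo/x₀^m`; (SM_m) says `(C₀ + C₁) x₀ ≤ s P`
  set P : ℝ := lo / x₀ ^ m with hP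
  have hP0 : 0 < P := div_pos hlo hxm
  have hPx : P * x₀ ^ m = lo := by rw [hP]; field_simp
  have hCx : (C₀ + C₁) * x₀ ≤ s * P := by
    have : (C₀ + C₁) * x₀ * x₀ ^ m ≤ s * P * x₀ ^ m := by
      calc (C₀ + C₁) * x₀ * x₀ ^ m = (C₀ + C₁) * x₀ ^ (m + 1) := by ring
        _ ≤ s * lo := hSM
        _ = s * P * x₀ ^ m := by rw [← hPx]; ring
    exact le_of_mul_le_mul_right this hxm
  have hC₁m : C₁ / m ≤ C₁ := div_le_self hC₁ hm'
  have hC₀x : C₀ * x₀ ≤ s * P := by nlinarith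
  have hCmx : (C₀ + C₁ / m) * x₀ ≤ s * P := by nlinarith
  have hC₀z : C₀ * z ≤ C₀ * x₀ := mul_le_mul_of_nonneg_left hzx hC₀
  have hCmz : (C₀ + C₁ / m) * z ≤ (C₀ + C₁ / m) * x₀ :=
    mul_le_mul_of_nonneg_left hzx (by positivity)
  have hden : (1 - 2 * s) * P ≤ nb - C₀ * z := by nlinarith
  have hden_pos : 0 < nb - C₀ * z := lt_of_lt_of_le (mul_pos h12s hP0) hden
  refine ⟨by linarith, ?_⟩
  rw [div_le_div_iff₀ hden_pos h12s]
  calc (C₀ + C₁ / m) * z * (1 - 2 * s) ≤ (s * P) * (1 - 2 * s) :=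
        mul_le_mul_of_nonneg_right (hCmz.trans hCmx) h12s.le
    _ = s * ((1 - 2 * s) * P) := by ring
    _ ≤ s * (nb - C₀ * z) := mul_le_mul_of_nonneg_left hden hs0

/-- THE TAIL LOG-PROFILE in the degree-`m` clock, `G r = ½ log ‖h(e^{−r/m})‖²`: its derivative. [folklore] -/
theorem hasDerivAt_logProfileDeg {m : ℕ} {h : ℝ → E} {w : E} {r : ℝ}
    (hd : HasDerivAt h w (Real.exp (-r / m))) (hne : h (Real.exp (-r / m)) ≠ 0) :
    HasDerivAt (fun r => (2 : ℝ)⁻¹ * Real.log (‖h (Real.exp (-r / m))‖ ^ 2))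
      ((2 : ℝ)⁻¹ * ((2 * ⟪h (Real.exp (-r / m)), w⟫ * (Real.exp (-r / m) * (-1 / m))) /
        ‖h (Real.exp (-r / m))‖ ^ 2)) r := by
  have he : HasDerivAt (fun r : ℝ => Real.exp (-r / m)) (Real.exp (-r / m) * (-1 / m)) r := by
    have h1 : HasDerivAt (fun r : ℝ => -r / m) (-1 / m) r := by
      simpa using ((hasDerivAt_id r).neg).div_const (m : ℝ)
    exact h1.exp
  have hq : HasDerivAt (fun r : ℝ => ‖h (Real.exp (-r / m))‖ ^ 2)
      (2 * ⟪h (Real.exp (-r / m)), w⟫ * (Real.exp (-r / m) * (-1 / m))) r := by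
    have := hd.norm_sq
    exact HasDerivAt.comp r this he
  have hpos : ‖h (Real.exp (-r / m))‖ ^ 2 ≠ 0 := pow_ne_zero 2 (norm_ne_zero_iff.2 hne)
  exact (hq.log hpos).const_mul _

/-- **RELATIVE EULER DEFECT ⇒ LOG-DERIVATIVE DEFECT** in the degree-`m` clock: if
`|m‖h z‖² − z⟨h z, w⟩| ≤ ε·m‖h z‖²` with `h z ≠ 0`, the derivative above is within `ε` of `−1`. [folklore] -/
theorem abs_logProfileDeg_deriv_add_one_le {m : ℕ} (hm : 0 < m) {v w : E} {z ε : ℝ} (hv : 0 < ‖v‖)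
    (hE : |(m : ℝ) * ‖v‖ ^ 2 - z * ⟪v, w⟫| ≤ ε * ((m : ℝ) * ‖v‖ ^ 2)) :
    |(2 : ℝ)⁻¹ * ((2 * ⟪v, w⟫ * (z * (-1 / m))) / ‖v‖ ^ 2) + 1| ≤ ε := by
  have hm' : (0 : ℝ) < m := Nat.cast_pos.2 hm
  have hN : 0 < (m : ℝ) * ‖v‖ ^ 2 := mul_pos hm' (pow_pos hv 2)
  have hid : (2 : ℝ)⁻¹ * ((2 * ⟪v, w⟫ * (z * (-1 / m))) / ‖v‖ ^ 2) + 1 =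
      ((m : ℝ) * ‖v‖ ^ 2 - z * ⟪v, w⟫) / ((m : ℝ) * ‖v‖ ^ 2) := by
    field_simp
    ring
  rw [hid, abs_div, abs_of_pos hN, div_le_iff₀ hN]
  exact hE

/-- A TRANSVERSAL near-homogeneous direction: `h` does not vanish on the physical range and the profile is
positive everywhere. [folklore] -/
theorem normProfileDeg_pos_of_transversal {m : ℕ} (hm : 0 < m) {h h' : ℝ → E} {b : E} {C₀ C₁ r₀ s lo : ℝ}
    (hC₀ : 0 ≤ C₀) (hC₁ : 0 ≤ C₁) (hs0 : 0 ≤ s) (hs : s < 1 / 2) (hlo : 0 < lo)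
    (hSM : (C₀ + C₁) * Real.exp (-r₀ / m) ^ (m + 1) ≤ s * lo)
    (hnl : ∀ z ∈ Ioc 0 (Real.exp (-r₀ / m)), HasDerivAt h (h' z) z ∧
      ‖h z - z ^ m • b‖ ≤ C₀ * z ^ (m + 1) ∧ ‖h' z - ((m : ℝ) * z ^ (m - 1)) • b‖ ≤ C₁ * z ^ m)
    (hb : lo / Real.exp (-r₀ / m) ^ m - C₀ * Real.exp (-r₀ / m) ≤ ‖b‖) :
    (∀ z ∈ Ioc 0 (Real.exp (-r₀ / m)), h z ≠ 0) ∧ ∀ r, 0 < normProfileDeg m h r₀ r := by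
  have hx₀ : 0 < Real.exp (-r₀ / m) := Real.exp_pos _
  have hne : ∀ z ∈ Ioc 0 (Real.exp (-r₀ / m)), h z ≠ 0 := fun z hz => by
    have htr := defect_le_of_transversalDeg hm hC₀ hC₁ hs0 hs hlo hx₀ hSM hb hz
    exact norm_pos_iff.1
      (relEulerDefect_of_nearHomogeneous hm hz.1 (hnl z hz).2.1 (hnl z hz).2.2 htr.1).2.1
  refine ⟨hne, fun r => ?_⟩
  unfold normProfileDeg
  exact mul_pos (norm_pos_iff.2 (hne _ (exp_neg_max_div_mem hm r))) (Real.exp_pos _)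

/-- **A TRANSVERSAL NEAR-HOMOGENEOUS DIRECTION IS TWO-SIDED** (in the degree-`m` clock) with defect `s/(1 − 2s)`
below every level (`T4ShellMeasureAnalytic.twoSidedBelow_tailExtend` BY NAME). [folklore] -/
theorem twoSidedBelow_log_normProfileDeg_of_transversal {m : ℕ} (hm : 0 < m) {h h' : ℝ → E} {b : E}
    {C₀ C₁ r₀ s lo : ℝ} (hC₀ : 0 ≤ C₀) (hC₁ : 0 ≤ C₁) (hs0 : 0 ≤ s) (hs : s < 1 / 2) (hlo : 0 < lo)
    (hSM : (C₀ + C₁) * Real.exp (-r₀ / m) ^ (m + 1) ≤ s * lo)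
    (hnl : ∀ z ∈ Ioc 0 (Real.exp (-r₀ / m)), HasDerivAt h (h' z) z ∧
      ‖h z - z ^ m • b‖ ≤ C₀ * z ^ (m + 1) ∧ ‖h' z - ((m : ℝ) * z ^ (m - 1)) • b‖ ≤ C₁ * z ^ m)
    (hb : lo / Real.exp (-r₀ / m) ^ m - C₀ * Real.exp (-r₀ / m) ≤ ‖b‖) (c : ℝ) :
    TwoSidedBelow (fun r => Real.log (normProfileDeg m h r₀ r)) (s / (1 - 2 * s)) c := by
  have hx₀ : 0 < Real.exp (-r₀ / m) := Real.exp_pos _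
  have hne := (normProfileDeg_pos_of_transversal hm hC₀ hC₁ hs0 hs hlo hSM hnl hb).1
  have h2s : 0 ≤ s / (1 - 2 * s) := div_nonneg hs0 (by linarith)
  have hfun : (fun r => Real.log (normProfileDeg m h r₀ r)) =
      tailExtend (fun r => (2 : ℝ)⁻¹ * Real.log (‖h (Real.exp (-r / m))‖ ^ 2)) r₀ :=
    funext (log_normProfileDeg_eq hm hne)
  rw [hfun]
  -- derivative and defect on the tail
  have hder : ∀ r, r₀ ≤ r → HasDerivAt (fun r => (2 : ℝ)⁻¹ * Real.log (‖h (Real.exp (-r / m))‖ ^ 2))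
      ((2 : ℝ)⁻¹ * ((2 * ⟪h (Real.exp (-r / m)), h' (Real.exp (-r / m))⟫ * (Real.exp (-r / m) * (-1 / m))) /
        ‖h (Real.exp (-r / m))‖ ^ 2)) r := fun r hr =>
    hasDerivAt_logProfileDeg (hnl _ (exp_neg_div_mem hm hr)).1 (hne _ (exp_neg_div_mem hm hr))
  refine twoSidedBelow_tailExtend h2s (fun r hr => (hder r hr).continuousAt.continuousWithinAt)
    (fun r hr => hder r hr.le) (fun r hr => ?_) c
  have hz := exp_neg_div_mem hm hr.le
  have htr := defect_le_of_transversalDeg hm hC₀ hC₁ hs0 hs hlo hx₀ hSM hb hz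
  obtain ⟨-, hp, hE⟩ :=
    relEulerDefect_of_nearHomogeneous hm hz.1 (hnl _ hz).2.1 (hnl _ hz).2.2 htr.1
  exact abs_logProfileDeg_deriv_add_one_le hm hp (hE.trans (mul_le_mul_of_nonneg_right htr.2 (by positivity)))

/-- **THE FIBRE ALTERNATIVE FOR ONE NEAR-HOMOGENEOUS DIRECTION OF DEGREE `m`.**  Near-homogeneity on the physical
range with constants `C₀, C₁`, the smallness relation (SM_m) with `s < 1/2`, and a density vanishing below `r₀`:
EITHER the direction is non-transversal and the shell `{θ(1 − ρ) ≤ normProfileDeg m < θ}` is `F`-null on the fibre,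
OR the profile is positive and its logarithm is two-sided with defect `s/(1 − 2s)` below every level. [folklore] -/
theorem fibre_alternative_of_nearHomogeneous {m : ℕ} (hm : 0 < m) {h h' : ℝ → E} {b : E}
    {C₀ C₁ r₀ s θ ρ : ℝ} {F : ℝ → ℝ≥0∞}
    (hC₀ : 0 ≤ C₀) (hC₁ : 0 ≤ C₁) (hs0 : 0 ≤ s) (hs : s < 1 / 2) (hθ : 0 < θ) (hρ1 : ρ < 1)
    (hSM : (C₀ + C₁) * Real.exp (-r₀ / m) ^ (m + 1) ≤ s * (θ * (1 - ρ)))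
    (hnl : ∀ z ∈ Ioc 0 (Real.exp (-r₀ / m)), HasDerivAt h (h' z) z ∧
      ‖h z - z ^ m • b‖ ≤ C₀ * z ^ (m + 1) ∧ ‖h' z - ((m : ℝ) * z ^ (m - 1)) • b‖ ≤ C₁ * z ^ m)
    (hF : ∀ r, r < r₀ → F r = 0) :
    (∀ r, θ * (1 - ρ) ≤ normProfileDeg m h r₀ r ∧ normProfileDeg m h r₀ r < θ → F r = 0) ∨
      ((∀ r, 0 < normProfileDeg m h r₀ r) ∧
        ∀ c, TwoSidedBelow (fun r => Real.log (normProfileDeg m h r₀ r)) (s / (1 - 2 * s)) c) := by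
  have hlo : 0 < θ * (1 - ρ) := mul_pos hθ (by linarith)
  by_cases hb : ‖b‖ < θ * (1 - ρ) / Real.exp (-r₀ / m) ^ m - C₀ * Real.exp (-r₀ / m)
  · refine Or.inl fun r hr => ?_
    by_cases hr₀ : r < r₀
    · exact hF r hr₀
    · have := normProfileDeg_lt_of_nonTransversal hm hC₀ (fun z hz => (hnl z hz).2.1) hb (not_lt.1 hr₀)
      exfalso; linarith [hr.1]
  · rw [not_lt] at hb
    exact Or.inr ⟨(normProfileDeg_pos_of_transversal hm hC₀ hC₁ hs0 hs hlo hSM hnl hb).2,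
      twoSidedBelow_log_normProfileDeg_of_transversal hm hC₀ hC₁ hs0 hs hlo hSM hnl hb⟩

/-- **THE FIBRE ALTERNATIVE FOR FINITELY MANY NEAR-HOMOGENEOUS DIRECTIONS OF DEGREE `m`** (the plaquettes of one
slot's territory — NO union bound): tested variable `u = sup'_p normProfileDeg m (h p)`; EITHER no direction is
transversal and the shell of `u` is `F`-null on the fibre, OR the `sup'` over the TRANSVERSAL directions is a
positive measurable proxy, two-sided with defect `s/(1 − 2s)` below every level, whose shell contains every
`F`-essential shell point of `u`. [folklore] -/
theorem fibre_alternative_of_nearHomogeneous_family {m : ℕ} (hm : 0 < m) {ι : Type*} {P : Finset ι}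
    (hP : P.Nonempty) {h h' : ι → ℝ → E} {b : ι → E} {C₀ C₁ r₀ s θ ρ : ℝ} {F : ℝ → ℝ≥0∞}
    (hC₀ : 0 ≤ C₀) (hC₁ : 0 ≤ C₁) (hs0 : 0 ≤ s) (hs : s < 1 / 2) (hθ : 0 < θ) (hρ1 : ρ < 1)
    (hSM : (C₀ + C₁) * Real.exp (-r₀ / m) ^ (m + 1) ≤ s * (θ * (1 - ρ)))
    (hnl : ∀ p ∈ P, ∀ z ∈ Ioc 0 (Real.exp (-r₀ / m)), HasDerivAt (h p) (h' p z) z ∧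
      ‖h p z - z ^ m • b p‖ ≤ C₀ * z ^ (m + 1) ∧ ‖h' p z - ((m : ℝ) * z ^ (m - 1)) • b p‖ ≤ C₁ * z ^ m)
    (hF : ∀ r, r < r₀ → F r = 0) :
    (∀ r, θ * (1 - ρ) ≤ P.sup' hP (fun p => normProfileDeg m (h p) r₀ r) ∧
        P.sup' hP (fun p => normProfileDeg m (h p) r₀ r) < θ → F r = 0) ∨
      ∃ v : ℝ → ℝ, Measurable v ∧ (∀ r, 0 < v r) ∧
        (∀ r, θ * (1 - ρ) ≤ P.sup' hP (fun p => normProfileDeg m (h p) r₀ r) ∧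
            P.sup' hP (fun p => normProfileDeg m (h p) r₀ r) < θ →
          F r = 0 ∨ (θ * (1 - ρ) ≤ v r ∧ v r < θ)) ∧
        ∀ c, TwoSidedBelow (fun r => Real.log (v r)) (s / (1 - 2 * s)) c := by
  classical
  have hlo : 0 < θ * (1 - ρ) := mul_pos hθ (by linarith)
  set x₀ : ℝ := Real.exp (-r₀ / m) with hx₀
  -- the transversal directions
  obtain ⟨T, hT⟩ : ∃ T : Finset ι, T = P.filter fun p => θ * (1 - ρ) / x₀ ^ m - C₀ * x₀ ≤ ‖b p‖ := ⟨_, rfl⟩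
  have hTP : T ⊆ P := by rw [hT]; exact Finset.filter_subset _ _
  have hmemT : ∀ {p}, p ∈ T ↔ p ∈ P ∧ θ * (1 - ρ) / x₀ ^ m - C₀ * x₀ ≤ ‖b p‖ := by
    intro p; rw [hT, Finset.mem_filter]
  -- on the physical tail a shell point of `u` is attained at a transversal direction
  have hreach : ∀ r, r₀ ≤ r → θ * (1 - ρ) ≤ P.sup' hP (fun p => normProfileDeg m (h p) r₀ r) →
      ∃ p ∈ T, P.sup' hP (fun p => normProfileDeg m (h p) r₀ r) = normProfileDeg m (h p) r₀ r := by
    intro r hr hur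
    obtain ⟨p, hp, he⟩ := Finset.exists_mem_eq_sup' hP fun p => normProfileDeg m (h p) r₀ r
    refine ⟨p, hmemT.2 ⟨hp, not_lt.1 fun hnb => ?_⟩, he⟩
    have := normProfileDeg_lt_of_nonTransversal hm hC₀ (fun z hz => ((hnl p hp) z hz).2.1) hnb hr
    rw [← he] at this
    linarith
  rcases T.eq_empty_or_nonempty with hTe | hTne
  · refine Or.inl fun r hr => ?_
    by_cases hr₀ : r < r₀
    · exact hF r hr₀
    · obtain ⟨p, hp, -⟩ := hreach r (not_lt.1 hr₀) hr.1
      rw [hTe] at hp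
      exact absurd hp (Finset.notMem_empty p)
  · have halt : ∀ p ∈ T, (∀ r, 0 < normProfileDeg m (h p) r₀ r) ∧
        ∀ c, TwoSidedBelow (fun r => Real.log (normProfileDeg m (h p) r₀ r)) (s / (1 - 2 * s)) c :=
      fun p hp =>
      ⟨(normProfileDeg_pos_of_transversal hm hC₀ hC₁ hs0 hs hlo hSM (hnl p (hmemT.1 hp).1) (hmemT.1 hp).2).2,
        twoSidedBelow_log_normProfileDeg_of_transversal hm hC₀ hC₁ hs0 hs hlo hSM (hnl p (hmemT.1 hp).1)
          (hmemT.1 hp).2⟩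
    obtain ⟨p₀, hp₀⟩ := id hTne
    refine Or.inr ⟨fun r => T.sup' hTne fun p => normProfileDeg m (h p) r₀ r, ?_, fun r => ?_, fun r hr => ?_,
      fun c => ?_⟩
    · have hmeas : Measurable (T.sup' hTne fun p => normProfileDeg m (h p) r₀) :=
        Finset.measurable_sup' hTne fun p hp =>
          (continuous_normProfileDeg hm fun z hz => ((hnl p (hTP hp)) z hz).1.continuousAt).measurable
      have hfun : (fun r => T.sup' hTne fun p => normProfileDeg m (h p) r₀ r) =
          T.sup' hTne fun p => normProfileDeg m (h p) r₀ := funext fun r => (Finset.sup'_apply hTne _ r).symm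
      rw [hfun]
      exact hmeas
    · exact (Finset.lt_sup'_iff hTne).2 ⟨p₀, hp₀, (halt p₀ hp₀).1 r⟩
    · by_cases hr₀ : r < r₀
      · exact Or.inl (hF r hr₀)
      · obtain ⟨p, hp, he⟩ := hreach r (not_lt.1 hr₀) hr.1
        refine Or.inr ⟨?_,
          lt_of_le_of_lt (Finset.sup'_mono (fun p => normProfileDeg m (h p) r₀ r) hTP hTne) hr.2⟩
        calc θ * (1 - ρ) ≤ normProfileDeg m (h p) r₀ r := he ▸ hr.1
          _ ≤ T.sup' hTne fun p => normProfileDeg m (h p) r₀ r :=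
            Finset.le_sup' (fun p => normProfileDeg m (h p) r₀ r) hp
    · have hfun : (fun r => Real.log (T.sup' hTne fun p => normProfileDeg m (h p) r₀ r)) =
          fun r => T.sup' hTne fun p => Real.log (normProfileDeg m (h p) r₀ r) :=
        funext fun r => log_sup'_eq_sup'_log hTne fun p hp => (halt p hp).1 r
      rw [hfun]
      exact TwoSidedBelow.finsetSup' hTne fun p hp => (halt p hp).2 c

end Inner

/-! ### §4(d) From the near-homogeneous family to the per-fibre hypothesis of `T4ShellMeasureAnalytic` §2 -/

/-- **(γ‴) PER FIBRE, ASSEMBLED.**  On a fibre `y` whose tested variable is the `sup'` of the degree-`m` norm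
profiles of a nonempty finite near-homogeneous family (constants `C₀, C₁`, physical range `(0, e^{−r₀/m}]`), under
(SM_m) with `s < 1/2`: if `F (y, ·)` vanishes below `r₀` and is forward log-Lipschitz with constant `B` on
`[r₀, ∞)`, then `T4ShellMeasureAnalytic.FibreAlternative F u (s/(1 − 2s)) σ B θ ρ L y` for EVERY onset `σ` and
window `L` — whence `slotAntiConcentration_of_fibreAlternative` / `slot_field_of_fibreAlternative` apply verbatim.
[folklore] -/
theorem fibreAlternative_of_nearHomogeneous_family {Y E ι : Type*} [NormedAddCommGroup E]
    [InnerProductSpace ℝ E] {m : ℕ} (hm : 0 < m) {F : Y × ℝ → ℝ≥0∞} {u : Y × ℝ → ℝ} {P : Finset ι}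
    (hP : P.Nonempty) {h h' : ι → ℝ → E} {b : ι → E} {C₀ C₁ r₀ s θ ρ B σ L : ℝ} (y : Y)
    (hC₀ : 0 ≤ C₀) (hC₁ : 0 ≤ C₁) (hs0 : 0 ≤ s) (hs : s < 1 / 2) (hθ : 0 < θ) (hρ1 : ρ < 1)
    (hSM : (C₀ + C₁) * Real.exp (-r₀ / m) ^ (m + 1) ≤ s * (θ * (1 - ρ)))
    (hnl : ∀ p ∈ P, ∀ z ∈ Ioc 0 (Real.exp (-r₀ / m)), HasDerivAt (h p) (h' p z) z ∧
      ‖h p z - z ^ m • b p‖ ≤ C₀ * z ^ (m + 1) ∧ ‖h' p z - ((m : ℝ) * z ^ (m - 1)) • b p‖ ≤ C₁ * z ^ m)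
    (hu : ∀ r, u (y, r) = P.sup' hP fun p => normProfileDeg m (h p) r₀ r)
    (hF0 : ∀ r, r < r₀ → F (y, r) = 0) (hFwd : FwdLogLipschitzOn (fun r => F (y, r)) B (Ici r₀)) :
    FibreAlternative F u (s / (1 - 2 * s)) σ B θ ρ L y := by
  rcases fibre_alternative_of_nearHomogeneous_family hm hP hC₀ hC₁ hs0 hs hθ hρ1 hSM hnl hF0 with
    hnull | ⟨v, hvm, hvpos, hincl, hts⟩
  · exact Or.inl fun r hr => hnull r (by rw [← hu r]; exact hr)
  · refine Or.inr ⟨v, hvm, hvpos, fun r hr => hincl r (by rw [← hu r]; exact hr), hts _, ?_⟩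
    exact FwdLogLipschitzOn.of_tail hF0 (hFwd.mono_set Set.inter_subset_right)

end NearHomogeneous

/-! ## §5 Non-vacuity: the exactly homogeneous model of degree `m` meets every hypothesis of §4 -/

section NonVacuity

variable {E : Type*} [NormedAddCommGroup E] [InnerProductSpace ℝ E]

/-- the exactly homogeneous direction `h z = z^m • b` is near-homogeneous of degree `m` with `C₀ = C₁ = 0`.
[folklore] -/
theorem nearHomogeneous_model (m : ℕ) (b : E) (z : ℝ) :
    HasDerivAt (fun w : ℝ => w ^ m • b) (((m : ℝ) * z ^ (m - 1)) • b) z ∧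
      ‖z ^ m • b - z ^ m • b‖ ≤ 0 * z ^ (m + 1) ∧
      ‖((m : ℝ) * z ^ (m - 1)) • b - ((m : ℝ) * z ^ (m - 1)) • b‖ ≤ 0 * z ^ m := by
  refine ⟨(hasDerivAt_pow m z).smul_const b, by simp, by simp⟩

/-- … so with `s = 0` the degree-`m` alternative holds for it against ANY tail-supported density, with defect `0`:
a TRANSVERSAL exactly homogeneous direction (`‖b‖ ≥ θ(1 − ρ) e^{r₀}`) has a positive profile with an exactly
unit-rate logarithm in the degree-`m` clock, a non-transversal one never reaches the shell. [folklore] -/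
example (m : ℕ) (hm : 0 < m) (b : E) (r₀ θ ρ : ℝ) (hθ : 0 < θ) (hρ1 : ρ < 1) (F : ℝ → ℝ≥0∞)
    (hF : ∀ r, r < r₀ → F r = 0) :
    (∀ r, θ * (1 - ρ) ≤ normProfileDeg m (fun w : ℝ => w ^ m • b) r₀ r ∧
        normProfileDeg m (fun w : ℝ => w ^ m • b) r₀ r < θ → F r = 0) ∨
      ((∀ r, 0 < normProfileDeg m (fun w : ℝ => w ^ m • b) r₀ r) ∧
        ∀ c, TwoSidedBelow (fun r => Real.log (normProfileDeg m (fun w : ℝ => w ^ m • b) r₀ r))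
          (0 / (1 - 2 * 0)) c) :=
  fibre_alternative_of_nearHomogeneous hm (b := b) (h' := fun z => ((m : ℝ) * z ^ (m - 1)) • b) (C₀ := 0)
    (C₁ := 0) le_rfl le_rfl le_rfl (by norm_num) hθ hρ1 (by simp) (fun z _ => nearHomogeneous_model m b z) hF

/-- the toron model of §1–§2 in these terms: the degree-`2` direction `z ↦ z² • c` (`c` = the commutator of the
two holonomy generators) with `C₀ = 0` REACHES the level `lo` inside the physical range `(0, x₀]` as soon as
`lo ≤ x₀²‖c‖` — the bad-toron band — and then it is degree-2-TRANSVERSAL (`‖c‖ ≥ lo/x₀² − 0·x₀`), i.e. it falls in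
the two-sided branch of (γ‴), while for (γ″) (degree `1`, `a = 0`) the same fibre refutes (SM) (§3). [folklore] -/
example (c : E) (lo x₀ : ℝ) (hx₀ : 0 < x₀) (hreach : lo ≤ x₀ ^ 2 * ‖c‖) :
    lo / x₀ ^ 2 - 0 * x₀ ≤ ‖c‖ ∧ lo ≤ ‖(fun w : ℝ => w ^ 2 • c) x₀‖ := by
  have hx2 : 0 < x₀ ^ 2 := pow_pos hx₀ 2
  refine ⟨by rw [zero_mul, sub_zero, div_le_iff₀ hx2]; linarith [mul_comm (x₀ ^ 2) ‖c‖], ?_⟩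
  simp only [norm_smul, Real.norm_eq_abs, abs_of_pos hx2]
  exact hreach

example (c : E) (C₁ s lo x₀ : ℝ) (hC₁ : 0 ≤ C₁) (hs : s < 1) (hlo : 0 < lo) (hx₀ : 0 < x₀)
    (hreach : lo ≤ x₀ ^ 2 * ‖c‖) : ¬ (‖c‖ + C₁) * x₀ ^ 2 ≤ s * lo :=
  not_SM_of_commutator_reach (h := fun w : ℝ => w ^ 2 • c) (κ := ‖c‖) hC₁ hs hlo hx₀
    (fun z hz => by rw [norm_smul, Real.norm_eq_abs, abs_of_pos (pow_pos hz.1 2), mul_comm])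
    (fun z hz => by rw [norm_smul, Real.norm_eq_abs, abs_of_pos (pow_pos hz.1 2), mul_comm])
    (by rwa [mul_comm] at hreach)

end NonVacuity

end Literature.MathematicalPhysics.QuantumFieldTheory.Balaban1983to89.T4ShellMeasureToron
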